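import Literature.MathematicalPhysics.QuantumManyBody.PeriodicBoseGasBogoliubov
import Literature.MathematicalPhysics.QuantumManyBody.PeriodicBoseGasBigW1Sharp
import HarnessLib

/-!
# Fournais 2020, Lemma 2.4: the adjoint `b_p†`, the pairing form, and the inputs (2.28), (2.42)

Topic `Literature/MathematicalPhysics/QuantumManyBody` (provefact
`Literature.MathematicalPhysics.QuantumManyBody.BoseGas.Fournais2020_condensation`, layer `Fournais2020_lemma24`).
With `b_pΦ` (`bVec`, `PeriodicBoseGasBogoliubov.lean`), the kinetic bound (2.30), the completion of
the square (2.33)–(2.36) (`PeriodicBoseGasBogoliubovSquare.lean`), the momentum integrals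
(2.36)–(2.41) (`PeriodicBoseGasBogoliubovIntegrals.lean`), `W₁ ≤ (1 + C(R/ℓ)²)g` and `|Ŵ₁| ≤ ∫W₁`
(`PeriodicBoseGasBigW1Sharp.lean`) and (2.32) (`PeriodicBoseGasBogoliubovPlancherel.lean`) in the tree,
the printed proof of [Fournais2020, Lemma 2.4] needs exactly three more inputs — (2.28), (2.29), (2.42).
This file defines the objects they speak about and vendors (2.28) and (2.42) as named facts (both
since proved: `Fournais2020_eq228_holds`, `PeriodicBoseGasEq228.lean`; `Fournais2020_eq242_holds`,
`PeriodicBoseGasEq242.lean`); (2.29) is the theorem `Fournais2020_eq229_of_rep` of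
`PeriodicBoseGasEq229.lean` (see the note below):

* `bDagVec χ ℓ u p Φ X = ∑ᵢ (Q(χ_Λ e^{2πi⟨·,p⟩}))(xᵢ) (PᵢΦ)(X)` — the adjoint of `b_pΦ` on `L²(Λⁿ)`
  (`b = ℓ⁻³∑ᵢ|1⟩⟨Qφ_p|ᵢ`, `φ_p = χ_Λe^{2πi⟨·,p⟩}`, hence `b† = ℓ⁻³∑ᵢ|Qφ_p⟩⟨1|ᵢ = ∑ᵢ (Qφ_p)(xᵢ)Pᵢ`,
  `Pᵢ = ℓ⁻³∫_Λ`; the paper's `b_k† = ℓ^{-3/2}a†(Qχ_Λe^{-ikx})a₀` (2.27) at `k = -2πp`);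
* `pairingRe χ ℓ u p Φ = Re⟨b_p†Φ, b_{-p}Φ⟩_{L²(Λⁿ)}` — the pairing expectation `Re⟨Φ, b b Φ⟩` of (2.29);
* `Fournais2020_eq228` — [Fournais2020, (2.28)] `[b_k, b_k†] ≤ n` on the `n`-sector, as
  `‖b_p†Φ‖² ≤ ‖b_pΦ‖² + n‖Φ‖²` (the printed `ℓ⁻³(a₀†a₀⟨χ_Λe,χ_Λe⟩ - a†(Qχe)a(Qχe)) ≤ n`, `∫χ² = 1`);
* (2.29) — [Fournais2020, (2.29)] "a direct calculation gives
  `A₂ = ½(2π)⁻³∫Ŵ₁(p)(b_p†b_{-p}† + b_pb_{-p})dp`", i.e. `⟨Φ,A₂Φ⟩ = ∫ Ŵ₁(p) Re⟨b_p†Φ, b_{-p}Φ⟩ dp`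
  (`𝓕` in Mathlib's convention, `Ŵ₁(k)` at `k = 2πp`; `Ŵ₁` is real and even) — is **not** a named
  fact: the paper states it as an operator identity and uses it only inside the proof of Lemma 2.4,
  an inequality on the form domain of the box Hamiltonian (finite norm, repulsion and kinetic form),
  and there it is the theorem `Fournais2020_eq229_of_rep` (`PeriodicBoseGasEq229.lean`; on bounded
  states `Fournais2020_eq229_bdd_holds`, `PeriodicBoseGasEq229Bdd.lean`), with the `p`-integral
  absolutely convergent (`∫(1+p²)‖b_pΦ‖² < ∞`, `sup_p‖b_p†Φ‖ < ∞` by (2.28), `∫|Ŵ₁|²/(1+p²) < ∞` by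
  (2.42)) and `⟨Φ,A₂Φ⟩` (`a2Form`, a Bochner integral against `w₁ ∈ L¹`) absolutely convergent by the
  finite repulsion. (A reading for all `Φ` of finite norm and kinetic form only would rest on the
  `-Δ`-form-boundedness of `W₁ ≤ Cg`, a Hardy-type input the paper neither states nor needs.)
* `Fournais2020_eq242` — [Fournais2020, (2.42) with (A.6)]: "`(2π)⁻³∫Ŵ₁(p)²/(2p²)dp = ∬W₁(x)W₁(y)/(2|x-y|) ≤
  (1+C(R/ℓ)²)(2π)⁻³∫ĝ²/(2p²) = (1+C(R/ℓ)²)∫gω`, where we used (A.6)" (`ω̂(k) = ĝ(k)/(2k²)`): in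
  Mathlib's convention `∫|𝓕W₁(p)|²/(8π²|p|²)dp ≤ (1 + 2C(R/ℓ)²)² ∫gω` (the Coulomb energy is quadratic,
  so the printed factor is squared here; `2C` is the constant of `inv_selfConv_le`).

The assembly of `Fournais2020_lemma24` from these (integrating `bogoliubov_completion` over `p`) is
`PeriodicBoseGasLemma24.lean` (inputs), `PeriodicBoseGasLemma24Bdd.lean` (pointwise in the state) and
`PeriodicBoseGasLemma24Proofs.lean` (`Fournais2020_lemma24_holds`).

## References

* [Fournais2020] S. Fournais, *Length scales for BEC in the dilute Bose gas*, arXiv:2011.00309,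
  EMS Ser. Congr. Rep. 18 (2021), doi:10.4171/ecr/18-1/7: Lemma 2.4, (2.27)–(2.29), (2.42), App. A (A.6).
* [FournaisSolovej2020] S. Fournais, J. P. Solovej, *The energy of dilute Bose gases*,
  Ann. of Math. 192 (2020) 893–976: §6, App. A.
-/

noncomputable section

open MeasureTheory Set
open scoped ENNReal NNReal FourierTransform ComplexConjugate RealInnerProductSpace

namespace Literature.MathematicalPhysics.QuantumManyBody.BoseGas

variable {n : ℕ}

/-! ### The adjoint `b_p†` and the pairing form -/

/-- The localised plane wave `φ_p(y) = χ_Λ(y) e^{2πi⟨y,p⟩}` of the box `Λ(u)` (`χ_Λe^{ikx}` of (2.27) at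
`k = 2πp`). [cite: Fournais2020, (2.27)] -/
def locWave (χ : Space → ℝ) (ℓ : ℝ) (u : Space) (p : Space) (y : Space) : ℂ :=
  (locFun χ ℓ u y : ℂ) * ((𝐞 (⟪y, p⟫)) : ℂ)

/-- **The function `b_p†Φ`** on `Λⁿ`: `∑ᵢ (Q_uφ_p)(xᵢ) (PᵢΦ)(X)`, the adjoint on `L²(Λ(u)ⁿ)` of
`Φ ↦ b_pΦ` (`bVec`; `b = ℓ⁻³∑ᵢ|1⟩⟨Qφ_p|ᵢ`, `b† = ∑ᵢ (Qφ_p)(xᵢ) Pᵢ` with `Pᵢ = ℓ⁻³∫_Λ dxᵢ` (2.5)), i.e.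
the paper's `b_k† = ℓ^{-3/2}a†(Qχ_Λe^{-ikx})a₀` (2.27) at `k = -2πp` on the `n`-sector. [cite: Fournais2020, (2.27)] -/
def bDagVec (χ : Space → ℝ) (ℓ : ℝ) (u : Space) (p : Space) (Φ : Config n → ℂ) (X : Config n) : ℂ :=
  ∑ i : Fin n, projQ ℓ u (locWave χ ℓ u p) (X i) * nbodyP ℓ u i Φ X

/-- **The pairing expectation** `Re⟨b_p†Φ, b_{-p}Φ⟩_{L²(Λⁿ)} = Re⟨Φ, b_pb_{-p}Φ⟩` of (2.29) (the
integrand of `A₂` in momentum space). [cite: Fournais2020, (2.29)] -/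
def pairingRe (χ : Space → ℝ) (ℓ : ℝ) (u : Space) (p : Space) (Φ : Config n → ℂ) : ℝ :=
  (∫ X in boxConfig n ℓ u, conj (bDagVec χ ℓ u p Φ X) * bVec χ ℓ u (-p) Φ X).re

/-! ### Named facts: (2.28), (2.42) -/

/-- **Fournais 2020, (2.28)** (the commutator bound). "Notice for later use that, on the
`n`-particle sector, `[b_k, b_k†] = ℓ⁻³(a₀†a₀⟨χ_Λe^{-ikx}, χ_Λe^{-ikx}⟩ - a†(Qχ_Λe^{-ikx})a(Qχ_Λe^{-ikx})) ≤ n`"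
(`∫χ² = 1`, `n₀ ≤ n`). In first quantisation, as the inequality of expectations
`‖b_p†Φ‖² ≤ ‖b_pΦ‖² + n‖Φ‖²` on `L²(Λ(u)ⁿ)` for every measurable `Φ` and every momentum.
[cite: Fournais2020, (2.28)] -/
def Fournais2020_eq228 : Prop :=
  ∀ (χ : Space → ℝ), IsLocalizationFunction χ →
  ∀ (ℓ : ℝ), 0 < ℓ → ∀ (u : Space) (n : ℕ) (Φ : Config n → ℂ), Measurable Φ →
  ∀ p : Space,
    ∫⁻ X in boxConfig n ℓ u, ((‖bDagVec χ ℓ u p Φ X‖₊ : ℝ≥0∞)) ^ 2 ≤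
      (∫⁻ X in boxConfig n ℓ u, ((‖bVec χ ℓ u p Φ X‖₊ : ℝ≥0∞)) ^ 2) +
        n * ∫⁻ X in boxConfig n ℓ u, ((‖Φ X‖₊ : ℝ≥0∞)) ^ 2

/-- **Fournais 2020, (2.42) with (A.6)** (the Coulomb energy of `W₁`). "Notice that
`0 ≤ W₁(x) ≤ (1 + C(R/ℓ)²)g(x)` … Therefore `(2π)⁻³∫Ŵ₁(p)²/(2p²)dp = ∬W₁(x)W₁(y)/(2|x-y|)dxdy ≤
(1 + C(R/ℓ)²)(2π)⁻³∫ĝ(p)²/(2p²)dp = (1 + C(R/ℓ)²)∫g(x)ω(x)dx`, where we used (A.6)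
[`ω̂(k) = ĝ(k)/(2k²)`] to get the last identity." In Mathlib's convention (`k = 2πp`) and with the
constant of `inv_selfConv_le` (the Coulomb energy being quadratic in `W₁`, the comparison factor
enters squared): `∫ |𝓕W₁(p)|²/(8π²|p|²) dp ≤ (1 + 2C(R/ℓ)²)² ∫ gω`, `g = v(1-ω)`.
[cite: Fournais2020, (2.42), App. A (A.6)] -/
def Fournais2020_eq242 : Prop :=
  ∀ (v : ℝ → ℝ≥0∞), IsRepulsiveFiniteRange v → (∫⁻ x : Space, v ‖x‖) ≠ ⊤ →
  ∀ (ω : Space → ℝ), IsScatteringSolution v ω →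
  ∀ (χ : Space → ℝ), IsLocalizationFunction χ →
  ∀ (C R : ℝ), 0 ≤ C → (∀ y : Space, 1 - C * ‖y‖ ^ 2 ≤ selfConv χ y) → 0 < R → (∀ r, R < r → v r = 0) →
  ∀ (ℓ : ℝ), 0 < ℓ → C * (R / ℓ) ^ 2 ≤ 1 / 2 →
    ∫⁻ p : Space, ENNReal.ofReal
        (‖𝓕 (fun x : Space => ((bigW₁ v ω χ ℓ x).toReal : ℂ)) p‖ ^ 2 / (8 * Real.pi ^ 2 * ‖p‖ ^ 2)) ≤
      ENNReal.ofReal ((1 + 2 * C * (R / ℓ) ^ 2) ^ 2) * gOmegaIntegral v ω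

/-! ### Basic API -/

/-- `|φ_p(y)| = |χ_Λ(y)|`. [cite: Fournais2020, (2.27)] -/
theorem norm_locWave (χ : Space → ℝ) (ℓ : ℝ) (u p y : Space) : ‖locWave χ ℓ u p y‖ = |locFun χ ℓ u y| := by
  rw [locWave, norm_mul, Complex.norm_real, Real.norm_eq_abs, Circle.norm_coe, mul_one]

/-- With no particles, `b_p†Φ = 0`. [cite: Fournais2020, (2.27)] -/
theorem bDagVec_zero (χ : Space → ℝ) (ℓ : ℝ) (u p : Space) (Φ : Config 0 → ℂ) (X : Config 0) :
    bDagVec χ ℓ u p Φ X = 0 := by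
  simp [bDagVec]

/-- With no particles, `b_pΦ = 0`. [cite: Fournais2020, (2.27)] -/
theorem bVec_zero (χ : Space → ℝ) (ℓ : ℝ) (u p : Space) (Φ : Config 0 → ℂ) (X : Config 0) :
    bVec χ ℓ u p Φ X = 0 := by
  simp [bVec]

/-- With no particles the pairing vanishes. [cite: Fournais2020, (2.29)] -/
theorem pairingRe_zero (χ : Space → ℝ) (ℓ : ℝ) (u p : Space) (Φ : Config 0 → ℂ) :
    pairingRe χ ℓ u p Φ = 0 := by
  simp [pairingRe, bVec_zero]

end Literature.MathematicalPhysics.QuantumManyBody.BoseGas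

end
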